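import Summits.KontsevichZagierPeriods.Zeta5Search.Barrier.ConeGammaCuspSymmetricSlope

/-!
# ζ(5) search — BARRIER: who carries the sign of `σ(δ) + σ(−δ)` — two-wall junctions are SIGN-DEFINITE, all-wall junctions push up

HONEST FRAMING (cell `pub-zeta5`): systematic search; no irrationality claim unless kernel-certified. MODEL objects
under Brown–Zudilin's (28)+(30) accounting ([BZ22] = arXiv:2210.03391; (28) observed, not proved); nothing here is a
statement about `ζ(5)`, any `γ` of record, the cone's supremum (C2 OPEN) or the VALUE of any reflection defect at
any named direction (those are DATA of the cell, `HOME/pub-zeta5-p2/g25/alg/twowall.py`); S-E stays CONJECTURED;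
records in print UNMOVED. Prover P2 g25, sequel of `ConeGammaCuspSymmetric(Slope)` (item (c) of P2 g23's list;
lead's words lit g37 INBOX l.9223 / l.9229; sequel plan l.9231, ruling YES / GO l.9232).

By `ConeGammaCuspSymmetricSlope` the symmetric part of the cusp slope is [end germs ≥ 0] + Σ over interior
breakpoints `b` of the four-germ sum `R_b(δ) = germR(δ) + germL(δ) + germR(−δ) + germL(−δ)` at `b` (= `∫₀^W` of
reflection defects); single-wall breakpoints give `R_b = 0`. Here (`θ_b = b·s(a)`; MEMBER forms at `b` = those `k`
with `b·h_k(a) ∈ ℤ`; all displacements below the wall distance):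
* **`torusN_eq_of_member_signs`** — `𝒩(θ_b + Δ)` depends on `Δ` only through the SIGNS of the member forms at `Δ`
  (non-member integer parts frozen: `floor_add_mul_eq_of_nonmember`, `wallDist_le`); hence the pair sum
  `𝒩(θ_b+Δ) + 𝒩(θ_b−Δ)` depends on the member-sign pattern only up to a global reversal
  (`torusN_pair_eq_of_member_signs`, `torusN_pair_eq_of_member_antisigns`).
* **TWO-WALL JUNCTIONS** (exactly two member forms `k₁ ≠ k₂`): the reflection defect
  `𝒩(θ_b+Δ) + 𝒩(θ_b−Δ) − 𝒩(θ_b+t·s) − 𝒩(θ_b−t·s)` is `0` when `φ_{k₁}(Δ)`, `φ_{k₂}(Δ)` have the same sign and equals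
  ONE number `D_b` — read at ANY mixed reference displacement `Δ₁` (`φ_{k₁}(Δ₁) > 0 > φ_{k₂}(Δ₁)`), independent of
  `Δ` — when they differ (`refl_two_wall_cases`); so **`germ_symm_sign_of_two_wall`**: `0 ≤ D_b ⇒ 0 ≤ R_b(δ)` and
  `D_b ≤ 0 ⇒ R_b(δ) ≤ 0` for EVERY `δ` (`0 < η`, `ηK < 1`, `ηK < wallDist`; a.e. on `[0, W]` the reflection-form
  integrand is a sum of two values in `{0, D_b}`, `refl_integrand_two_wall_sign`): a two-wall junction votes with
  a FIXED SIGN in every displacement direction (its weight, the splitting `|φ_{k₁}(δ)/h_{k₁} − φ_{k₂}(δ)/h_{k₂}|`,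
  is the desk identity `K_b(δ)+K_b(−δ) = D_b·|r₁ − r₂|`, DATA, not restated here).
* **ALL-WALL JUNCTIONS** (all 28 forms integral at `b`: an interior copy of the lattice point, e.g. the half period
  of a ray all of whose pair sums are even): `germR_eq_germR_zero_of_allWalls` (`periodic_torusN_line` with period
  `b`; the left germ is `germL_period`), **`germ_symm_nonneg_of_allWalls`** (each one-sided germ `≥ 0`).
* **`cuspSlope_symm_nonneg_of_junction_types`**, **`cuspSlope_eq_zero_of_symm_nonneg_of_isLocalMax`** —
  COROLLARY: if every interior breakpoint is single-wall, all-wall, or two-wall with `D_b ≥ 0`, then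
  `0 ≤ σ(δ) + σ(−δ)`, and a Regular open-box local maximiser of `γ` with `Q > 0` on such an orbit is CUSP-FREE
  (`σ(δ) = 0`; extends `cuspSlope_eq_zero_of_single_walls_of_isLocalMax`). So a cusp top of the MODEL `γ` must carry
  a two-wall junction with `D_b < 0` or a `≥ 3`-wall (not all-wall) junction with negative reflection defect.
NOT here (honest): the value of any `D_b` in the kernel (DATA: `D_b ∈ {−1,0,+1}` at record / flag / argmax-120, mostly
`0`), `≥ 3`-wall junctions other than the all-wall case, anything about `γ` of record, C2, S-E, `ζ(5)`.
-/

noncomputable section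

open Set MeasureTheory
open scoped Topology

namespace Summit.KontsevichZagierPeriods.Zeta5Search.Barrier.ConeGamma

/-- **Near a breakpoint the saving sees only the SIGNS of the member forms.** Let `b ∈ bkpts a T` and `Δ, Δ'` two
displacements whose 28 forms are `< 1` and `< wallDist a T` in size, such that every MEMBER form (`b·h_k(a) ∈ ℤ`)
has the same strict sign at `Δ` and `Δ'`. Then `𝒩(b·s(a) + Δ) = 𝒩(b·s(a) + Δ')`. -/
theorem torusN_eq_of_member_signs {a : Dir} {T b : ℝ} (hb : b ∈ bkpts a T) {Δ Δ' : Fin 8 → ℝ}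
    (hΔ1 : ∀ k, |phiForm Δ k| < 1) (hΔ2 : ∀ k, |phiForm Δ k| < wallDist a T)
    (hΔ'1 : ∀ k, |phiForm Δ' k| < 1) (hΔ'2 : ∀ k, |phiForm Δ' k| < wallDist a T)
    (hsign : ∀ k, (∃ z : ℤ, b * h28 a k = z) →
      (0 < phiForm Δ k ∧ 0 < phiForm Δ' k) ∨ (phiForm Δ k < 0 ∧ phiForm Δ' k < 0)) :
    torusN (b • sParam a + Δ) = torusN (b • sParam a + Δ') := by
  refine torusN_congr_floor fun i j hij => ?_
  wlog hlt : i < j generalizing i j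
  · have hji : j < i := lt_of_le_of_ne (not_lt.mp hlt) (Ne.symm hij)
    rw [pairForm_comm _ i j, pairForm_comm (b • sParam a + Δ') i j]
    exact this j i hij.symm hji
  rw [pairForm_add, pairForm_add, pairForm_eq_phiForm_idxOf _ hlt, pairForm_eq_phiForm_idxOf _ hlt,
    pairForm_eq_phiForm_idxOf _ hlt, phiForm_smul_sParam]
  by_cases hm : ∃ z : ℤ, b * h28 a (idxOf i j) = z
  · obtain ⟨z, hz⟩ := hm
    rcases hsign _ ⟨z, hz⟩ with ⟨hp, hp'⟩ | ⟨hn, hn'⟩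
    · rw [hz, floor_intCast_add_of_pos_lt_one hp (abs_lt.mp (hΔ1 _)).2,
        floor_intCast_add_of_pos_lt_one hp' (abs_lt.mp (hΔ'1 _)).2]
    · rw [hz, floor_intCast_add_of_neg_gt_neg_one (abs_lt.mp (hΔ1 _)).1 hn,
        floor_intCast_add_of_neg_gt_neg_one (abs_lt.mp (hΔ'1 _)).1 hn']
  · push Not at hm
    have key : ∀ Δ'' : Fin 8 → ℝ, (∀ k, |phiForm Δ'' k| < wallDist a T) →
        ⌊b * h28 a (idxOf i j) + phiForm Δ'' (idxOf i j)⌋ = ⌊b * h28 a (idxOf i j)⌋ := fun Δ'' hΔ'' => by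
      simpa only [one_mul] using floor_add_mul_eq_of_nonmember (x := b * h28 a (idxOf i j))
        (y := phiForm Δ'' (idxOf i j)) (fun z => (hΔ'' _).trans_le (wallDist_le hb _ hm z)) zero_le_one le_rfl
    rw [key Δ hΔ2, key Δ' hΔ'2]

/-- Forms of the line step `t·s(a)`: `φ_k(t·s(a)) = t·h_k(a)`, of size `≤ t·x_max`. -/
theorem abs_phiForm_line_step {a : Dir} (hpos : ∀ k, 0 < h28 a k) {t : ℝ} (ht : 0 < t) (k : Fin 28) :
    |phiForm (t • sParam a) k| = t * h28 a k ∧ t * h28 a k ≤ t * xMax a := by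
  rw [phiForm_smul_sParam, abs_of_pos (mul_pos ht (hpos k))]
  exact ⟨rfl, mul_le_mul_of_nonneg_left (le_xMax a k) ht.le⟩

/-- **Pair sums under a common member-sign pattern.** If every member form has the same strict sign at `Δ` and at
`Δ'` (both small), then `𝒩(θ_b+Δ) + 𝒩(θ_b−Δ) = 𝒩(θ_b+Δ') + 𝒩(θ_b−Δ')`. -/
theorem torusN_pair_eq_of_member_signs {a : Dir} {T b : ℝ} (hb : b ∈ bkpts a T) {Δ Δ' : Fin 8 → ℝ}
    (hΔ1 : ∀ k, |phiForm Δ k| < 1) (hΔ2 : ∀ k, |phiForm Δ k| < wallDist a T)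
    (hΔ'1 : ∀ k, |phiForm Δ' k| < 1) (hΔ'2 : ∀ k, |phiForm Δ' k| < wallDist a T)
    (hsign : ∀ k, (∃ z : ℤ, b * h28 a k = z) →
      (0 < phiForm Δ k ∧ 0 < phiForm Δ' k) ∨ (phiForm Δ k < 0 ∧ phiForm Δ' k < 0)) :
    torusN (b • sParam a + Δ) + torusN (b • sParam a - Δ) =
      torusN (b • sParam a + Δ') + torusN (b • sParam a - Δ') := by
  have hn : ∀ Δ'' : Fin 8 → ℝ, ∀ c : ℝ, (∀ k, |phiForm Δ'' k| < c) → ∀ k, |phiForm (-Δ'') k| < c :=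
    fun Δ'' c h k => by rw [phiForm_neg, abs_neg]; exact h k
  rw [sub_eq_add_neg, sub_eq_add_neg, torusN_eq_of_member_signs hb hΔ1 hΔ2 hΔ'1 hΔ'2 hsign,
    torusN_eq_of_member_signs hb (hn Δ 1 hΔ1) (hn Δ _ hΔ2) (hn Δ' 1 hΔ'1) (hn Δ' _ hΔ'2) (fun k hk => ?_)]
  rw [phiForm_neg, phiForm_neg]
  rcases hsign k hk with ⟨h1, h2⟩ | ⟨h1, h2⟩
  · exact Or.inr ⟨by linarith, by linarith⟩
  · exact Or.inl ⟨by linarith, by linarith⟩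

/-- **Pair sums under OPPOSITE member-sign patterns.** If every member form has opposite strict signs at `Δ` and
`Δ'`, then again `𝒩(θ_b+Δ) + 𝒩(θ_b−Δ) = 𝒩(θ_b+Δ') + 𝒩(θ_b−Δ')` (the two summands swap): the pair sum — hence the
reflection defect — depends on the member-sign pattern only up to a global reversal. -/
theorem torusN_pair_eq_of_member_antisigns {a : Dir} {T b : ℝ} (hb : b ∈ bkpts a T) {Δ Δ' : Fin 8 → ℝ}
    (hΔ1 : ∀ k, |phiForm Δ k| < 1) (hΔ2 : ∀ k, |phiForm Δ k| < wallDist a T)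
    (hΔ'1 : ∀ k, |phiForm Δ' k| < 1) (hΔ'2 : ∀ k, |phiForm Δ' k| < wallDist a T)
    (hsign : ∀ k, (∃ z : ℤ, b * h28 a k = z) →
      (0 < phiForm Δ k ∧ phiForm Δ' k < 0) ∨ (phiForm Δ k < 0 ∧ 0 < phiForm Δ' k)) :
    torusN (b • sParam a + Δ) + torusN (b • sParam a - Δ) =
      torusN (b • sParam a + Δ') + torusN (b • sParam a - Δ') := by
  have hn : ∀ Δ'' : Fin 8 → ℝ, ∀ c : ℝ, (∀ k, |phiForm Δ'' k| < c) → ∀ k, |phiForm (-Δ'') k| < c :=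
    fun Δ'' c h k => by rw [phiForm_neg, abs_neg]; exact h k
  rw [sub_eq_add_neg, sub_eq_add_neg, add_comm (torusN (b • sParam a + Δ')),
    torusN_eq_of_member_signs hb hΔ1 hΔ2 (hn Δ' 1 hΔ'1) (hn Δ' _ hΔ'2) (fun k hk => ?_),
    torusN_eq_of_member_signs hb (hn Δ 1 hΔ1) (hn Δ _ hΔ2) hΔ'1 hΔ'2 (fun k hk => ?_)]
  · rw [phiForm_neg]
    rcases hsign k hk with ⟨h1, h2⟩ | ⟨h1, h2⟩
    · exact Or.inr ⟨by linarith, h2⟩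
    · exact Or.inl ⟨by linarith, h2⟩
  · rw [phiForm_neg]
    rcases hsign k hk with ⟨h1, h2⟩ | ⟨h1, h2⟩
    · exact Or.inl ⟨h1, by linarith⟩
    · exact Or.inr ⟨h1, by linarith⟩

/-! ### Two-wall junctions -/

/-- **The reflection defect at a two-wall junction takes two values, `0` and `D_b`.** For a small `Δ` with
`φ_{k₁}(Δ) ≠ 0`, `φ_{k₂}(Δ) ≠ 0` and a small line step `t > 0`:
`𝒩(θ_b+Δ) + 𝒩(θ_b−Δ) − (𝒩(θ_b+t·s) + 𝒩(θ_b−t·s)) ∈ {0, D_b}`, `D_b` read at the reference `Δ₁`. -/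
theorem refl_two_wall_cases {a : Dir} (hpos : ∀ k, 0 < h28 a k) {T b : ℝ} (hb : b ∈ bkpts a T)
    {k₁ k₂ : Fin 28} (hother : ∀ k, k ≠ k₁ → k ≠ k₂ → ∀ z : ℤ, b * h28 a k ≠ z) {Δ Δ₁ : Fin 8 → ℝ}
    (hΔ1 : ∀ k, |phiForm Δ k| < 1) (hΔ2 : ∀ k, |phiForm Δ k| < wallDist a T)
    (hΔ₁1 : ∀ k, |phiForm Δ₁ k| < 1) (hΔ₁2 : ∀ k, |phiForm Δ₁ k| < wallDist a T)
    (hm1 : 0 < phiForm Δ₁ k₁) (hm2 : phiForm Δ₁ k₂ < 0) (hne1 : phiForm Δ k₁ ≠ 0) (hne2 : phiForm Δ k₂ ≠ 0)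
    {t : ℝ} (ht : 0 < t) (ht1 : t * xMax a < 1) (ht2 : t * xMax a < wallDist a T) :
    (torusN (b • sParam a + Δ) : ℝ) + torusN (b • sParam a - Δ) -
        (torusN (b • sParam a + t • sParam a) + torusN (b • sParam a - t • sParam a)) = 0 ∨
      (torusN (b • sParam a + Δ) : ℝ) + torusN (b • sParam a - Δ) -
        (torusN (b • sParam a + t • sParam a) + torusN (b • sParam a - t • sParam a)) =
      (torusN (b • sParam a + Δ₁) : ℝ) + torusN (b • sParam a - Δ₁) -
        (torusN (b • sParam a + t • sParam a) + torusN (b • sParam a - t • sParam a)) := by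
  have hT1 : ∀ k, |phiForm (t • sParam a) k| < 1 := fun k => by
    obtain ⟨e, le⟩ := abs_phiForm_line_step hpos ht k; rw [e]; exact le.trans_lt ht1
  have hT2 : ∀ k, |phiForm (t • sParam a) k| < wallDist a T := fun k => by
    obtain ⟨e, le⟩ := abs_phiForm_line_step hpos ht k; rw [e]; exact le.trans_lt ht2
  have hpt : ∀ k, 0 < phiForm (t • sParam a) k := fun k => by rw [phiForm_smul_sParam]; exact mul_pos ht (hpos k)
  have hmem : ∀ k, (∃ z : ℤ, b * h28 a k = z) → k = k₁ ∨ k = k₂ := by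
    intro k ⟨z, hz⟩
    by_contra h
    push Not at h
    exact hother k h.1 h.2 z hz
  -- same signs: compare with the line step; mixed signs: compare with the reference `Δ₁`
  rcases lt_or_gt_of_ne hne1 with h1 | h1 <;> rcases lt_or_gt_of_ne hne2 with h2 | h2
  · left; rw [sub_eq_zero]
    exact_mod_cast torusN_pair_eq_of_member_antisigns hb hΔ1 hΔ2 hT1 hT2 fun k hk => by
      rcases hmem k hk with rfl | rfl
      · exact Or.inr ⟨h1, hpt _⟩
      · exact Or.inr ⟨h2, hpt _⟩
  · right
    have e := torusN_pair_eq_of_member_antisigns hb hΔ1 hΔ2 hΔ₁1 hΔ₁2 fun k hk => by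
      rcases hmem k hk with rfl | rfl
      · exact Or.inr ⟨h1, hm1⟩
      · exact Or.inl ⟨h2, hm2⟩
    have e' : (torusN (b • sParam a + Δ) : ℝ) + torusN (b • sParam a - Δ) =
        torusN (b • sParam a + Δ₁) + torusN (b • sParam a - Δ₁) := by exact_mod_cast e
    rw [e']
  · right
    have e := torusN_pair_eq_of_member_signs hb hΔ1 hΔ2 hΔ₁1 hΔ₁2 fun k hk => by
      rcases hmem k hk with rfl | rfl
      · exact Or.inl ⟨h1, hm1⟩
      · exact Or.inr ⟨h2, hm2⟩
    have e' : (torusN (b • sParam a + Δ) : ℝ) + torusN (b • sParam a - Δ) =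
        torusN (b • sParam a + Δ₁) + torusN (b • sParam a - Δ₁) := by exact_mod_cast e
    rw [e']
  · left; rw [sub_eq_zero]
    exact_mod_cast torusN_pair_eq_of_member_signs hb hΔ1 hΔ2 hT1 hT2 fun k hk => by
      rcases hmem k hk with rfl | rfl
      · exact Or.inl ⟨h1, hpt _⟩
      · exact Or.inl ⟨h2, hpt _⟩

/-- The reflection-form integrand at a two-wall junction is `≥ 0` off a finite set when `D_b ≥ 0`, and `≤ 0` off a
finite set when `D_b ≤ 0` (pointwise form of the sign-definiteness; `w ∈ (0, W]`, `w·h_{k_i} ≠ ∓φ_{k_i}(δ)`). -/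
theorem refl_integrand_two_wall_sign {a : Dir} (hpos : ∀ k, 0 < h28 a k) {T b : ℝ} (hb : b ∈ bkpts a T)
    {k₁ k₂ : Fin 28} (hother : ∀ k, k ≠ k₁ → k ≠ k₂ → ∀ z : ℤ, b * h28 a k ≠ z) (δ : Fin 8 → ℝ)
    {η : ℝ} (hη : 0 < η) (h1 : η * clusterBound a δ < 1) (h2 : η * clusterBound a δ < wallDist a T)
    {Δ₁ : Fin 8 → ℝ} (hΔ₁1 : ∀ k, |phiForm Δ₁ k| < 1) (hΔ₁2 : ∀ k, |phiForm Δ₁ k| < wallDist a T)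
    (hm1 : 0 < phiForm Δ₁ k₁) (hm2 : phiForm Δ₁ k₂ < 0) {t : ℝ} (ht : 0 < t) (ht1 : t * xMax a < 1)
    (ht2 : t * xMax a < wallDist a T) {w : ℝ} (hw0 : 0 < w) (hwW : w ≤ clusterWidth a δ)
    (hw1p : w * h28 a k₁ + phiForm δ k₁ ≠ 0) (hw1m : w * h28 a k₁ - phiForm δ k₁ ≠ 0)
    (hw2p : w * h28 a k₂ + phiForm δ k₂ ≠ 0) (hw2m : w * h28 a k₂ - phiForm δ k₂ ≠ 0) :
    (0 ≤ (torusN (b • sParam a + Δ₁) : ℝ) + torusN (b • sParam a - Δ₁) -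
        (torusN (b • sParam a + t • sParam a) + torusN (b • sParam a - t • sParam a)) →
      0 ≤ (shiftDiff a δ η (b + η * w) + shiftDiff a (-δ) η (b - η * w)) +
        (shiftDiff a (-δ) η (b + η * w) + shiftDiff a δ η (b - η * w))) ∧
    ((torusN (b • sParam a + Δ₁) : ℝ) + torusN (b • sParam a - Δ₁) -
        (torusN (b • sParam a + t • sParam a) + torusN (b • sParam a - t • sParam a)) ≤ 0 →
      (shiftDiff a δ η (b + η * w) + shiftDiff a (-δ) η (b - η * w)) +
        (shiftDiff a (-δ) η (b + η * w) + shiftDiff a δ η (b - η * w)) ≤ 0) := by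
  have hwabs : |w| ≤ clusterWidth a δ := by rw [abs_of_pos hw0]; exact hwW
  have hYn : shiftSize (-δ) ≤ shiftSize δ := (shiftSize_neg δ).le
  have hDp1 : ∀ k, |phiForm (η • (w • sParam a + δ)) k| < 1 := fun k =>
    (abs_phiForm_disp_le hpos δ le_rfl hwabs hη.le k).trans_lt h1
  have hDp2 : ∀ k, |phiForm (η • (w • sParam a + δ)) k| < wallDist a T := fun k =>
    (abs_phiForm_disp_le hpos δ le_rfl hwabs hη.le k).trans_lt h2
  have hDm1 : ∀ k, |phiForm (η • (w • sParam a + -δ)) k| < 1 := fun k =>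
    (abs_phiForm_disp_le hpos δ hYn hwabs hη.le k).trans_lt h1
  have hDm2 : ∀ k, |phiForm (η • (w • sParam a + -δ)) k| < wallDist a T := fun k =>
    (abs_phiForm_disp_le hpos δ hYn hwabs hη.le k).trans_lt h2
  have hs : 0 < η * w := mul_pos hη hw0
  have hsx : η * w * xMax a ≤ η * clusterBound a δ := by
    calc η * w * xMax a ≤ η * clusterWidth a δ * xMax a :=
          mul_le_mul_of_nonneg_right (mul_le_mul_of_nonneg_left hwW hη.le) (xMax_pos hpos).le
      _ ≤ η * clusterBound a δ := by
          rw [mul_assoc]; exact mul_le_mul_of_nonneg_left (clusterWidth_mul_xMax_le_clusterBound a δ) hη.le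
  have hs1 : η * w * xMax a < 1 := hsx.trans_lt h1
  have hs2 : η * w * xMax a < wallDist a T := hsx.trans_lt h2
  have hform : ∀ (δ' : Fin 8 → ℝ) (k : Fin 28),
      phiForm (η • (w • sParam a + δ')) k = η * (w * h28 a k + phiForm δ' k) := by
    intro δ' k
    rw [show η • (w • sParam a + δ') = η • (w • sParam a) + η • δ' by rw [smul_add], phiForm_add, smul_smul,
      phiForm_smul_sParam, phiForm_eq (η • δ'), pairForm_smul, ← phiForm_eq]
    ring
  have hne : ∀ (δ' : Fin 8 → ℝ) (k : Fin 28), w * h28 a k + phiForm δ' k ≠ 0 →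
      phiForm (η • (w • sParam a + δ')) k ≠ 0 := fun δ' k h => by
    rw [hform]; exact mul_ne_zero hη.ne' h
  have hm1' : w * h28 a k₁ + phiForm (-δ) k₁ ≠ 0 := by rw [phiForm_neg, ← sub_eq_add_neg]; exact hw1m
  have hm2' : w * h28 a k₂ + phiForm (-δ) k₂ ≠ 0 := by rw [phiForm_neg, ← sub_eq_add_neg]; exact hw2m
  -- the baseline at `w` equals the baseline at `t` (all members positive along the line)
  have hlin : ∀ (c : ℝ), 0 < c → c * xMax a < 1 → c * xMax a < wallDist a T →
      (∀ k, |phiForm (c • sParam a) k| < 1) ∧ (∀ k, |phiForm (c • sParam a) k| < wallDist a T) := fun c hc hc1 hc2 =>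
    ⟨fun k => by obtain ⟨e, le⟩ := abs_phiForm_line_step hpos hc k; rw [e]; exact le.trans_lt hc1,
     fun k => by obtain ⟨e, le⟩ := abs_phiForm_line_step hpos hc k; rw [e]; exact le.trans_lt hc2⟩
  have hbase := torusN_pair_eq_of_member_signs hb (hlin _ hs hs1 hs2).1 (hlin _ hs hs1 hs2).2
    (hlin t ht ht1 ht2).1 (hlin t ht ht1 ht2).2 (Δ := (η * w) • sParam a) (Δ' := t • sParam a) fun k _ =>
      Or.inl ⟨by rw [phiForm_smul_sParam]; exact mul_pos hs (hpos k),
        by rw [phiForm_smul_sParam]; exact mul_pos ht (hpos k)⟩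
  have hbase' : (torusN (b • sParam a + (η * w) • sParam a) : ℝ) + torusN (b • sParam a - (η * w) • sParam a) =
      torusN (b • sParam a + t • sParam a) + torusN (b • sParam a - t • sParam a) := by exact_mod_cast hbase
  -- the two brackets
  have r1 := shiftDiff_add_shiftDiff_neg_reflect a δ η b w
  have r2 := shiftDiff_add_shiftDiff_neg_reflect a (-δ) η b w
  rw [neg_neg] at r2
  have c1 := refl_two_wall_cases hpos hb hother hDp1 hDp2 hΔ₁1 hΔ₁2 hm1 hm2 (hne δ k₁ hw1p) (hne δ k₂ hw2p)
    ht ht1 ht2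
  have c2 := refl_two_wall_cases hpos hb hother hDm1 hDm2 hΔ₁1 hΔ₁2 hm1 hm2 (hne (-δ) k₁ hm1') (hne (-δ) k₂ hm2')
    ht ht1 ht2
  have hF : (shiftDiff a δ η (b + η * w) + shiftDiff a (-δ) η (b - η * w)) +
      (shiftDiff a (-δ) η (b + η * w) + shiftDiff a δ η (b - η * w)) = ((torusN (b • sParam a + η • (w • sParam a + δ)) : ℝ) + torusN (b • sParam a - η • (w • sParam a + δ)) -
        (torusN (b • sParam a + t • sParam a) + torusN (b • sParam a - t • sParam a))) +
      ((torusN (b • sParam a + η • (w • sParam a + -δ)) : ℝ) + torusN (b • sParam a - η • (w • sParam a + -δ)) -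
        (torusN (b • sParam a + t • sParam a) + torusN (b • sParam a - t • sParam a))) := by
    rw [r1, r2, hbase']
  constructor
  · intro hD
    rw [hF]
    rcases c1 with e1 | e1 <;> rcases c2 with e2 | e2 <;> rw [e1, e2] <;> linarith
  · intro hD
    rw [hF]
    rcases c1 with e1 | e1 <;> rcases c2 with e2 | e2 <;> rw [e1, e2] <;> linarith

/-- **TWO-WALL JUNCTIONS ARE SIGN-DEFINITE.** Let `b ∈ bkpts a T` carry exactly two integral forms `k₁ ≠ k₂`
(`hother`), and let `D_b = 𝒩(θ_b+Δ₁) + 𝒩(θ_b−Δ₁) − 𝒩(θ_b+t·s) − 𝒩(θ_b−t·s)` be read at any small MIXED reference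
displacement `Δ₁` (`φ_{k₁}(Δ₁) > 0 > φ_{k₂}(Δ₁)`) and small line step `t > 0`. Then for EVERY displacement `δ` and
every scale `0 < η` with `ηK < 1`, `ηK < wallDist`: `0 ≤ D_b ⇒` the four-germ sum at `b` is `≥ 0`, and `D_b ≤ 0 ⇒`
it is `≤ 0` — the junction votes with a fixed sign in every displacement direction (a.e. on `[0, W]` the
reflection-form integrand is a sum of two values in `{0, D_b}`, `refl_integrand_two_wall_sign`). -/
theorem germ_symm_sign_of_two_wall {a : Dir} (hpos : ∀ k, 0 < h28 a k) {T b : ℝ} (hb : b ∈ bkpts a T)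
    {k₁ k₂ : Fin 28} (hother : ∀ k, k ≠ k₁ → k ≠ k₂ → ∀ z : ℤ, b * h28 a k ≠ z) (δ : Fin 8 → ℝ)
    {η : ℝ} (hη : 0 < η) (h1 : η * clusterBound a δ < 1) (h2 : η * clusterBound a δ < wallDist a T)
    {Δ₁ : Fin 8 → ℝ} (hΔ₁1 : ∀ k, |phiForm Δ₁ k| < 1) (hΔ₁2 : ∀ k, |phiForm Δ₁ k| < wallDist a T)
    (hm1 : 0 < phiForm Δ₁ k₁) (hm2 : phiForm Δ₁ k₂ < 0) {t : ℝ} (ht : 0 < t) (ht1 : t * xMax a < 1)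
    (ht2 : t * xMax a < wallDist a T) :
    (0 ≤ (torusN (b • sParam a + Δ₁) : ℝ) + torusN (b • sParam a - Δ₁) -
        (torusN (b • sParam a + t • sParam a) + torusN (b • sParam a - t • sParam a)) →
      0 ≤ germR a δ η b + germL a δ η b + germR a (-δ) η b + germL a (-δ) η b) ∧
    ((torusN (b • sParam a + Δ₁) : ℝ) + torusN (b • sParam a - Δ₁) -
        (torusN (b • sParam a + t • sParam a) + torusN (b • sParam a - t • sParam a)) ≤ 0 →
      germR a δ η b + germL a δ η b + germR a (-δ) η b + germL a (-δ) η b ≤ 0) := by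
  rw [germ_symm_eq_integral_refl]
  have hW := clusterWidth_pos hpos δ
  set B : Set ℝ := {0, (-phiForm δ k₁) / h28 a k₁, phiForm δ k₁ / h28 a k₁, (-phiForm δ k₂) / h28 a k₂,
    phiForm δ k₂ / h28 a k₂} with hBdef
  have hBfin : B.Finite := by
    rw [hBdef]
    exact ((((Set.finite_singleton _).insert _).insert _).insert _).insert _
  have hae : ∀ᵐ w ∂volume, w ∉ B := (measure_eq_zero_iff_ae_notMem).mp (hBfin.measure_zero volume)
  -- a.e. on `[0, W]` the integrand has the sign of `D_b`
  have hpt : ∀ᵐ w ∂(volume.restrict (Icc 0 (clusterWidth a δ))),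
      (0 ≤ (torusN (b • sParam a + Δ₁) : ℝ) + torusN (b • sParam a - Δ₁) -
          (torusN (b • sParam a + t • sParam a) + torusN (b • sParam a - t • sParam a)) →
        0 ≤ (shiftDiff a δ η (b + η * w) + shiftDiff a (-δ) η (b - η * w)) +
          (shiftDiff a (-δ) η (b + η * w) + shiftDiff a δ η (b - η * w))) ∧
      ((torusN (b • sParam a + Δ₁) : ℝ) + torusN (b • sParam a - Δ₁) -
          (torusN (b • sParam a + t • sParam a) + torusN (b • sParam a - t • sParam a)) ≤ 0 →
        (shiftDiff a δ η (b + η * w) + shiftDiff a (-δ) η (b - η * w)) +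
          (shiftDiff a (-δ) η (b + η * w) + shiftDiff a δ η (b - η * w)) ≤ 0) := by
    rw [ae_restrict_iff' measurableSet_Icc]
    filter_upwards [hae] with w hwB hwI
    have hk1 := hpos k₁
    have hk2 := hpos k₂
    have hw0 : 0 < w := lt_of_le_of_ne hwI.1 fun h => hwB (by rw [hBdef, ← h]; exact Or.inl rfl)
    have mk : ∀ {k : Fin 28} {c : ℝ}, 0 < h28 a k → w ≠ c / h28 a k → w * h28 a k - c ≠ 0 := by
      intro k c hk hne h
      exact hne (by field_simp; linarith)
    have n1p : w ≠ (-phiForm δ k₁) / h28 a k₁ := fun h => hwB (by rw [hBdef]; exact Or.inr (Or.inl h))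
    have n1m : w ≠ phiForm δ k₁ / h28 a k₁ := fun h => hwB (by rw [hBdef]; exact Or.inr (Or.inr (Or.inl h)))
    have n2p : w ≠ (-phiForm δ k₂) / h28 a k₂ := fun h =>
      hwB (by rw [hBdef]; exact Or.inr (Or.inr (Or.inr (Or.inl h))))
    have n2m : w ≠ phiForm δ k₂ / h28 a k₂ := fun h =>
      hwB (by rw [hBdef]; exact Or.inr (Or.inr (Or.inr (Or.inr h))))
    have e1p : w * h28 a k₁ + phiForm δ k₁ ≠ 0 := by have := mk hk1 n1p; rwa [sub_neg_eq_add] at this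
    have e2p : w * h28 a k₂ + phiForm δ k₂ ≠ 0 := by have := mk hk2 n2p; rwa [sub_neg_eq_add] at this
    exact refl_integrand_two_wall_sign hpos hb hother δ hη h1 h2 hΔ₁1 hΔ₁2 hm1 hm2 ht ht1 ht2 hw0 hwI.2
      e1p (mk hk1 n1m) e2p (mk hk2 n2m)
  constructor
  · intro hD
    exact intervalIntegral.integral_nonneg_of_ae_restrict hW.le (hpt.mono fun w hw => hw.1 hD)
  · intro hD
    rw [← neg_nonneg, ← intervalIntegral.integral_neg]
    refine intervalIntegral.integral_nonneg_of_ae_restrict hW.le (hpt.mono fun w hw => ?_)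
    have := hw.2 hD
    simp only [Pi.zero_apply]
    linarith

/-! ### All-wall junctions: interior copies of the lattice point -/

/-- **At a breakpoint where ALL 28 forms are integral the right germ is the right germ at `0`** (`b` is itself a
period of the orbit: `periodic_torusN_line`). -/
theorem germR_eq_germR_zero_of_allWalls {a : Dir} {b : ℝ} (hall : ∀ k : Fin 28, ∃ z : ℤ, b * h28 a k = z)
    (δ : Fin 8 → ℝ) (η : ℝ) : germR a δ η b = germR a δ η 0 := by
  unfold germR shiftDiff
  refine intervalIntegral.integral_congr fun w _ => ?_
  have hε := (periodic_torusN_line hall (η • δ)) (0 + η * w)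
  have h0 := (periodic_torusN_line hall (0 : Fin 8 → ℝ)) (0 + η * w)
  simp only [add_zero] at hε h0
  rw [show b + η * w = 0 + η * w + b by ring, hε, h0]

/-- **ALL-WALL JUNCTIONS PUSH UP**: at a breakpoint where all 28 forms are integral, each one-sided germ is `≥ 0`
for EVERY displacement (`0 ≤ η`, `ηK < 1`), hence so is the four-germ sum — exactly as at the lattice point (the
left germ is the case `T := b` of `germL_period_nonneg`; the right one by `germR_eq_germR_zero_of_allWalls`). -/
theorem germ_symm_nonneg_of_allWalls {a : Dir} (hpos : ∀ k, 0 < h28 a k) {b : ℝ}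
    (hall : ∀ k : Fin 28, ∃ z : ℤ, b * h28 a k = z) (δ : Fin 8 → ℝ) {η : ℝ} (hη : 0 ≤ η)
    (h1 : η * clusterBound a δ < 1) :
    0 ≤ germR a δ η b ∧ 0 ≤ germL a δ η b ∧
      0 ≤ germR a δ η b + germL a δ η b + germR a (-δ) η b + germL a (-δ) η b := by
  have h1' : η * clusterBound a (-δ) < 1 := by rw [clusterBound_neg]; exact h1
  have eR : ∀ δ' : Fin 8 → ℝ, η * clusterBound a δ' < 1 → 0 ≤ germR a δ' η b := fun δ' h => by
    rw [germR_eq_germR_zero_of_allWalls hall]; exact germR_zero_nonneg hpos δ' hη h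
  have eL : ∀ δ' : Fin 8 → ℝ, η * clusterBound a δ' < 1 → 0 ≤ germL a δ' η b := fun δ' h =>
    germL_period_nonneg hpos hall δ' hη h
  exact ⟨eR δ h1, eL δ h1, add_nonneg (add_nonneg (add_nonneg (eR δ h1) (eL δ h1)) (eR _ h1')) (eL _ h1')⟩

/-- **COROLLARY (extends `cuspSlope_symm_nonneg_of_single_walls`).** If every interior breakpoint `b_{m+1}` of the
period is a SINGLE wall, or an ALL-WALL junction, or a TWO-WALL junction whose reflection defect `D_b` (read at some
mixed reference displacement `Δ₁` and line step `t` below the wall distance) is `≥ 0`, then `0 ≤ σ(δ) + σ(−δ)`. -/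
theorem cuspSlope_symm_nonneg_of_junction_types {a : Dir} (hpos : ∀ k, 0 < h28 a k) {T : ℝ} (hT : 0 < T)
    (hper : ∀ k : Fin 28, ∃ z : ℤ, T * h28 a k = z) (δ : Fin 8 → ℝ) {ρ : ℝ} (hρ : 0 < ρ)
    (h1 : ρ * clusterBound a δ < 1) (h2 : ρ * clusterBound a δ < wallDist a T)
    (hgap : ∀ m, m + 1 < (bkpts a T).card → 2 * ρ * clusterWidth a δ ≤ bkpt a T (m + 1) - bkpt a T m)
    (htype : ∀ m, m + 2 < (bkpts a T).card →
      (∃ k₀ : Fin 28, (∃ z : ℤ, bkpt a T (m + 1) * h28 a k₀ = z) ∧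
        ∀ k, k ≠ k₀ → ∀ z : ℤ, bkpt a T (m + 1) * h28 a k ≠ z) ∨
      (∀ k : Fin 28, ∃ z : ℤ, bkpt a T (m + 1) * h28 a k = z) ∨
      (∃ (k₁ k₂ : Fin 28) (Δ₁ : Fin 8 → ℝ) (t : ℝ),
        (∀ k, k ≠ k₁ → k ≠ k₂ → ∀ z : ℤ, bkpt a T (m + 1) * h28 a k ≠ z) ∧
        (∀ k, |phiForm Δ₁ k| < 1) ∧ (∀ k, |phiForm Δ₁ k| < wallDist a T) ∧
        0 < phiForm Δ₁ k₁ ∧ phiForm Δ₁ k₂ < 0 ∧ 0 < t ∧ t * xMax a < 1 ∧ t * xMax a < wallDist a T ∧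
        0 ≤ (torusN (bkpt a T (m + 1) • sParam a + Δ₁) : ℝ) + torusN (bkpt a T (m + 1) • sParam a - Δ₁) -
          (torusN (bkpt a T (m + 1) • sParam a + t • sParam a) +
            torusN (bkpt a T (m + 1) • sParam a - t • sParam a)))) :
    0 ≤ cuspSlope a T δ + cuspSlope a T (-δ) := by
  rw [cuspSlope_add_cuspSlope_neg_eq hpos hT hper δ hρ h1 h2 hgap]
  refine add_nonneg (endGerms_nonneg hpos hper δ hρ.le h1) (Finset.sum_nonneg fun m hm => ?_)
  have hm' : m + 2 < (bkpts a T).card := by have := Finset.mem_range.mp hm; omega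
  have hb : bkpt a T (m + 1) ∈ bkpts a T := bkpt_mem (by omega)
  rcases htype m hm' with ⟨k₀, hk₀, hother⟩ | hall | ⟨k₁, k₂, Δ₁, t, hother, hΔ₁1, hΔ₁2, hm1, hm2, ht, ht1, ht2, hD⟩
  · exact (germ_symm_eq_zero_of_single_wall hpos hb hk₀ hother δ hρ h1 h2).symm.le
  · exact (germ_symm_nonneg_of_allWalls hpos hall δ hρ.le h1).2.2
  · exact (germ_symm_sign_of_two_wall hpos hb hother δ hρ h1 h2 hΔ₁1 hΔ₁2 hm1 hm2 ht ht1 ht2).1 hD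

/-- **A local maximiser with non-negative symmetric part is cusp-free along `±δ`.** At a Regular OPEN-box direction
with `Q > 0` that is a local maximiser of `γ`, `0 ≤ σ(δ) + σ(−δ)` forces `σ(δ) = 0` (P2 g23's
`cuspSlope_nonpos_of_isLocalMax` gives `σ(±δ) ≤ 0`). With `cuspSlope_symm_nonneg_of_junction_types`: an orbit whose
interior junctions are single-wall, all-wall or two-wall with `D_b ≥ 0` can be a local maximiser of `γ` only if it is
CUSP-FREE — a cusp top of the MODEL `γ` must carry a two-wall junction with `D_b < 0` or a `≥ 3`-wall junction (not
all-wall) with negative reflection defect, in every displacement direction. -/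
theorem cuspSlope_eq_zero_of_symm_nonneg_of_isLocalMax {a : Dir}
    (hopen : ∀ j : Fin 7, 0 < sParam a j.succ ∧ sParam a j.succ < sParam a 0)
    {T : ℝ} (hT : 0 < T) (hper : ∀ k : Fin 28, ∃ z : ℤ, T * h28 a k = z) (δ : Fin 8 → ℝ)
    (hQ : 0 < C1 a + delta28 a - phi30 a) (hreg : Regular a) (hmax : IsLocalMax gamma a)
    (hsym : 0 ≤ cuspSlope a T δ + cuspSlope a T (-δ)) : cuspSlope a T δ = 0 := by
  have s1 := cuspSlope_nonpos_of_isLocalMax hopen hT hper δ hQ hreg hmax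
  have s2 := cuspSlope_nonpos_of_isLocalMax hopen hT hper (-δ) hQ hreg hmax
  linarith

end Summit.KontsevichZagierPeriods.Zeta5Search.Barrier.ConeGamma

end
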